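import Mathlib
import HarnessLib

/-!
# Crux `TameLocalReceptacle` (stmt-ABC-14354): the ALL-SQUARE three-triple certificate

Arithmetic of the certificate used by the unconditional refutation of the QUADRATIC-LOCAL face of
`Summit.ABC.ABC.Theses.CongruentialReceptacle.TameLocalReceptacle`
(`Theorems/TameLocalReceptacle/Negative/TameLocalReceptacleQuadraticLocal.lean`, lead
`prover-line-stmt-ABC-14354-0`).  With a prime `s ≡ 2 (mod 9)` (Dirichlet), `q ≡ 1 (mod 90)` the largest
such number `≤ s/3`, `r = q − 4`, `X = r⁴`, `W = q⁴`, `y = 16W − X`, `Y = s⁴`, `18w = Y − y`, `x = 32w − y`,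
the abc-triples `T⁻ = (x, y, 32w)`, `T₁⁺ = (x, Y, 50w)`, `T₂⁺ = (X, y, 16W)` share their members position
by position, and the MULTIPLIERS `32 = 2·4²`, `50 = 2·5²`, `16 = 4²`, `18 = 2·3²` are squares up to the
common factor `2`: this is what makes the partner residues and unit residues of the shared atoms agree
UP TO SQUARES modulo every odd prime, so that a table reading residues only through Legendre symbols
cannot tell the shared atoms apart.  This file only constructs the nine numbers and their elementary
properties (sizes, parities, residues mod `3`, `5`, coprimality); no table appears here.
-/

-- `Summit.<Summit>.<Problem>` is the mandated summit-side namespace (CONVENTIONS §2); for the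
-- single-conjunct summit `ABC` the two coincide, so the duplicate `ABC.ABC` is deliberate.
set_option linter.dupNamespace false

namespace Summit.ABC.ABC.Theorems.TameLocalReceptacle

/-- Fourth powers of odd numbers are `≡ 1 (mod 16)`. [folklore] -/
theorem pow_four_mod_sixteen {r : ℕ} (h : r % 2 = 1) : r ^ 4 % 16 = 1 := by
  rw [Nat.pow_mod]
  have h16 : r % 16 < 16 := Nat.mod_lt _ (by norm_num)
  have hodd : (r % 16) % 2 = 1 := by rw [Nat.mod_mod_of_dvd r (by norm_num : 2 ∣ 16)]; exact h
  interval_cases hr : r % 16 <;> simp_all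

/-- Fourth powers of numbers prime to `5` are `≡ 1 (mod 5)`. [folklore] -/
theorem pow_four_mod_five' {r : ℕ} (h : r % 5 ≠ 0) : r ^ 4 % 5 = 1 := by
  rw [Nat.pow_mod]
  have h5 : r % 5 < 5 := Nat.mod_lt _ (by norm_num)
  interval_cases hr : r % 5 <;> simp_all

/-- `y = 16(r+4)⁴ − r⁴` factors as `(r+8)(3r+8)(5r²+32r+64)`. [folklore] -/
theorem sixteen_pow_four_sub (r : ℕ) :
    (r + 8) * (3 * r + 8) * (5 * r ^ 2 + 32 * r + 64) + r ^ 4 = 16 * (r + 4) ^ 4 := by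
  ring

/-- Residue bookkeeping for the certificate (small `omega` lemmas, kept out of the main context).
[folklore] -/
theorem cert_aux_dvd18 {y Y : ℕ} (hY9 : Y % 9 = 7) (hy9 : y % 9 = 7) (hY2 : Y % 2 = 1)
    (hy2 : y % 2 = 1) (h : y ≤ Y) : 18 ∣ Y - y := by omega

/-- `w` is odd. [folklore] -/
theorem cert_aux_w2 {w y Y : ℕ} (h : 18 * w + y = Y) (hY : Y % 16 = 1) (hy : y % 16 = 15) :
    w % 2 = 1 := by omega

/-- `5 ∤ w`. [folklore] -/
theorem cert_aux_w5 {w y Y : ℕ} (h : 18 * w + y = Y) (hY : Y % 5 = 1) (hy : y % 5 = 0) :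
    w % 5 ≠ 0 := by omega

/-- `x` is odd and prime to `5`. [folklore] -/
theorem cert_aux_x {x y w : ℕ} (h : x + y = 32 * w) (hy2 : y % 2 = 1) (hy5 : y % 5 = 0)
    (hw5 : w % 5 ≠ 0) : x % 2 = 1 ∧ x % 5 ≠ 0 := by omega

/-- Linear size bookkeeping for the certificate (small `omega` lemma). [folklore] -/
theorem cert_aux_sizes {s q r a : ℕ} (hr4 : r + 4 = q) (h3q : 3 * q ≤ s) (ha : 3 * q + a = s)
    (hs3q : s < 3 * q + 273) (hq : 300000 ≤ q) :
    a ≤ 272 ∧ r + 8 < s ∧ 3 * r + 8 < s := by omega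

/-- `y < Y`. [folklore] -/
theorem cert_aux_yY {y X W Y : ℕ} (hyX : y + X = 16 * W) (hXW : X < W) (h81 : 81 * W ≤ Y) :
    y < Y := by omega

/-- More linear bookkeeping: `y < Y`, `y ≤ 32w`, `0 < w`, `x + Y = 50w`. [folklore] -/
theorem cert_aux_lin {x y X W Y w : ℕ} (hyX : y + X = 16 * W) (hXW : X < W) (h81 : 81 * W ≤ Y)
    (hw : 18 * w + y = Y) : y < Y ∧ y ≤ 32 * w ∧ 0 < w ∧ (x + y = 32 * w → x + Y = 50 * w) := by
  omega

set_option maxHeartbeats 400000 in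
/-- **The all-square certificate.** Above any `S₀` there are a prime `s` and naturals
`q, r, X, W, y, Y, w, x` with `X = r⁴`, `W = q⁴`, `Y = s⁴`, `y + X = 16W`, `18w + y = Y`, `x + y = 32w`,
`x + Y = 50w`, the size relations `X < W ≤ 2²⁰X`, `81W ≤ Y ≤ 256W`, the parities / residues
(`r, q, s, w, x, y` odd; `3 ∤ y`, `5 ∤ x`, `5 ∤ w`, `s ≠ 5`) and the coprimalities that make
`(x, y, 32w)`, `(x, Y, 50w)`, `(X, y, 16W)` abc-triples (`x ⊥ y`, `x ⊥ Y`, `X ⊥ y`, `r ⊥ q`, `s ⊥ y`,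
`s ⊥ w`).  Construction: `s ≡ 2 (mod 9)` prime (Dirichlet), `q = 90⌊(s/3 − 1)/90⌋ + 1`, `r = q − 4`.
[folklore] -/
theorem ql_certificate (S₀ : ℕ) : ∃ s q r X W y Y w x : ℕ,
    S₀ ≤ s ∧ s.Prime ∧ X = r ^ 4 ∧ W = q ^ 4 ∧ Y = s ^ 4 ∧
    y + X = 16 * W ∧ 18 * w + y = Y ∧ x + y = 32 * w ∧ x + Y = 50 * w ∧
    X < W ∧ W ≤ 2 ^ 20 * X ∧ 81 * W ≤ Y ∧ Y ≤ 256 * W ∧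
    0 < r ∧ 0 < w ∧ 0 < x ∧ 0 < y ∧
    r % 2 = 1 ∧ q % 2 = 1 ∧ s % 2 = 1 ∧ w % 2 = 1 ∧ x % 2 = 1 ∧ y % 2 = 1 ∧
    y % 3 ≠ 0 ∧ x % 5 ≠ 0 ∧ w % 5 ≠ 0 ∧ s ≠ 5 ∧
    Nat.Coprime r q ∧ Nat.Coprime s y ∧ Nat.Coprime s w ∧
    Nat.Coprime x y ∧ Nat.Coprime x Y ∧ Nat.Coprime X y := by
  -- Step 1: a prime s ≡ 2 (mod 9) above max S₀ 10⁶ (Dirichlet)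
  obtain ⟨s, hsgt, hs, hsmod⟩ := Nat.forall_exists_prime_gt_and_zmodEq (max S₀ 1000000) (q := 9)
    (a := 2) (by norm_num) (by norm_num)
  have hS₀ : S₀ ≤ s := le_of_lt (lt_of_le_of_lt (le_max_left _ _) hsgt)
  have hsbig : 1000000 < s := lt_of_le_of_lt (le_max_right _ _) hsgt
  have hs9 : s % 9 = 2 := by
    have h := hsmod
    rw [Int.ModEq] at h
    omega
  clear hsmod hsgt
  have hs2 : s % 2 = 1 := by
    rcases hs.eq_two_or_odd' with h | h
    · omega
    · exact Nat.odd_iff.mp h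
  have hs5 : s ≠ 5 := by omega
  have hs5' : s % 5 ≠ 0 := by
    intro h
    have h5 : 5 ∣ s := Nat.dvd_of_mod_eq_zero h
    have := (Nat.prime_dvd_prime_iff_eq (by norm_num) hs).mp h5
    omega
  -- Step 2: q ≡ 1 (mod 90) with 3q ≤ s < 3q + 273, and r = q - 4
  obtain ⟨q, hq⟩ : ∃ q : ℕ, q = 90 * ((s / 3 - 1) / 90) + 1 := ⟨_, rfl⟩
  have hq90 : q % 90 = 1 := by omega
  have h3q : 3 * q ≤ s := by omega
  have hs3q : s < 3 * q + 273 := by omega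
  have hqbig : 300000 ≤ q := by omega
  have h4q : s ≤ 4 * q := by omega
  clear hq
  obtain ⟨r, hr4⟩ : ∃ r : ℕ, r + 4 = q := ⟨q - 4, by omega⟩
  have hr2 : r % 2 = 1 := by omega
  have hq2 : q % 2 = 1 := by omega
  have hr9 : r % 9 = 6 := by omega
  have hq9 : q % 9 = 1 := by omega
  have hr5 : r % 5 = 2 := by omega
  have hq5 : q % 5 = 1 := by omega
  have hr0 : 0 < r := by omega
  -- Step 3: X, W, y
  obtain ⟨X, hX⟩ : ∃ X : ℕ, X = r ^ 4 := ⟨_, rfl⟩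
  obtain ⟨W, hW⟩ : ∃ W : ℕ, W = q ^ 4 := ⟨_, rfl⟩
  have hrq : r < q := by omega
  have hXW : X < W := by rw [hX, hW]; exact Nat.pow_lt_pow_left hrq (by norm_num)
  have hq32 : q ≤ 32 * r := by omega
  have hWX : W ≤ 2 ^ 20 * X := by
    rw [hW, hX]
    calc q ^ 4 ≤ (32 * r) ^ 4 := Nat.pow_le_pow_left hq32 4
      _ = 2 ^ 20 * r ^ 4 := by ring
  have hX16 : X % 16 = 1 := by rw [hX]; exact pow_four_mod_sixteen hr2
  have hW16 : W % 16 = 1 := by rw [hW]; exact pow_four_mod_sixteen hq2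
  have hX9 : X % 9 = 0 := by rw [hX, Nat.pow_mod, hr9]
  have hW9 : W % 9 = 1 := by rw [hW, Nat.pow_mod, hq9]
  have hr5' : r % 5 ≠ 0 := by omega
  have hq5' : q % 5 ≠ 0 := by omega
  have hX5 : X % 5 = 1 := by rw [hX]; exact pow_four_mod_five' hr5'
  have hW5 : W % 5 = 1 := by rw [hW]; exact pow_four_mod_five' hq5'
  obtain ⟨y, hyX⟩ : ∃ y : ℕ, y + X = 16 * W := ⟨16 * W - X, Nat.sub_add_cancel (by omega)⟩
  have hy2 : y % 2 = 1 := by omega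
  have hy9 : y % 9 = 7 := by omega
  have hy5 : y % 5 = 0 := by omega
  have hy16 : y % 16 = 15 := by omega
  have hy0 : 0 < y := by omega
  have hy3 : y % 3 ≠ 0 := by rw [← Nat.mod_mod_of_dvd y (by norm_num : 3 ∣ 9), hy9]; norm_num
  -- Step 4: Y = s⁴, and s ∤ y
  obtain ⟨Y, hY⟩ : ∃ Y : ℕ, Y = s ^ 4 := ⟨_, rfl⟩
  have hY16 : Y % 16 = 1 := by rw [hY]; exact pow_four_mod_sixteen hs2
  have hY9 : Y % 9 = 7 := by rw [hY, Nat.pow_mod, hs9]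
  have hY5 : Y % 5 = 1 := by rw [hY]; exact pow_four_mod_five' hs5'
  have h81 : 81 * W ≤ Y := by
    rw [hW, hY]
    calc 81 * q ^ 4 = (3 * q) ^ 4 := by ring
      _ ≤ s ^ 4 := Nat.pow_le_pow_left h3q 4
  have h256 : Y ≤ 256 * W := by
    rw [hW, hY]
    calc s ^ 4 ≤ (4 * q) ^ 4 := Nat.pow_le_pow_left h4q 4
      _ = 256 * q ^ 4 := by ring
  -- numeric facts for `s ∤ y`, prepared before the divisibility argument
  obtain ⟨a, ha'⟩ := Nat.exists_eq_add_of_le h3q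
  have ha : 3 * q + a = s := ha'.symm
  obtain ⟨ha272, hlt1, hlt2⟩ := cert_aux_sizes hr4 h3q ha hs3q hqbig
  have hM : 5 * a ^ 2 + 24 * a + 144 < s :=
    calc 5 * a ^ 2 + 24 * a + 144 ≤ 5 * 272 ^ 2 + 24 * 272 + 144 := by gcongr
      _ < 1000000 := by norm_num
      _ < s := hsbig
  have hid : 9 * (5 * r ^ 2 + 32 * r + 64) + 5 * a * s
      = (5 * a ^ 2 + 24 * a + 144) + s * (15 * r + 36) := by
    rw [← ha, ← hr4]; ring
  have hsy : ¬ s ∣ y := by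
    intro hd
    -- the factorisation of y (kept local: nonlinear facts upset `omega` elsewhere)
    have hyfac : y = (r + 8) * (3 * r + 8) * (5 * r ^ 2 + 32 * r + 64) := by
      have h1 := sixteen_pow_four_sub r
      rw [hr4] at h1
      have h2 : y + r ^ 4 = (r + 8) * (3 * r + 8) * (5 * r ^ 2 + 32 * r + 64) + r ^ 4 := by
        rw [h1, ← hW, ← hX]; exact hyX
      exact Nat.add_right_cancel h2
    have hd' : s ∣ (r + 8) * (3 * r + 8) * (5 * r ^ 2 + 32 * r + 64) := hyfac ▸ hd
    rcases (Nat.Prime.dvd_mul hs).mp hd' with h12 | h3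
    · rcases (Nat.Prime.dvd_mul hs).mp h12 with h1 | h2
      · exact absurd (Nat.le_of_dvd (Nat.succ_pos _) h1) (not_le.mpr hlt1)
      · exact absurd (Nat.le_of_dvd (Nat.succ_pos _) h2) (not_le.mpr hlt2)
    · -- s ∣ N := 5r² + 32r + 64: 9N + 5as = M + s(15r + 36) with M = 5a² + 24a + 144 < s
      have hdvd1 : s ∣ 9 * (5 * r ^ 2 + 32 * r + 64) + 5 * a * s :=
        dvd_add (dvd_mul_of_dvd_right h3 9) (dvd_mul_left s (5 * a))
      rw [hid, add_comm] at hdvd1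
      have hdvdM : s ∣ 5 * a ^ 2 + 24 * a + 144 := (Nat.dvd_add_right (dvd_mul_right s _)).mp hdvd1
      exact absurd (Nat.le_of_dvd (Nat.succ_pos _) hdvdM) (not_le.mpr hM)
  have cop_s_y : Nat.Coprime s y := (Nat.Prime.coprime_iff_not_dvd hs).mpr hsy
  -- Step 5: w with 18w + y = Y, and x = 32w - y
  have hyY : y < Y := cert_aux_yY hyX hXW h81
  have hY2 : Y % 2 = 1 := by rw [← Nat.mod_mod_of_dvd Y (by norm_num : 2 ∣ 16), hY16]
  have h18 : 18 ∣ Y - y := cert_aux_dvd18 hY9 hy9 hY2 hy2 hyY.le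
  obtain ⟨w, hw⟩ : ∃ w : ℕ, 18 * w + y = Y :=
    ⟨(Y - y) / 18, by rw [Nat.mul_div_cancel' h18, Nat.sub_add_cancel hyY.le]⟩
  have hw2 : w % 2 = 1 := cert_aux_w2 hw hY16 hy16
  have hw5 : w % 5 ≠ 0 := cert_aux_w5 hw hY5 hy5
  obtain ⟨-, h32, hw0, -⟩ := cert_aux_lin (x := 0) hyX hXW h81 hw
  obtain ⟨x, hx⟩ : ∃ x : ℕ, x + y = 32 * w := ⟨32 * w - y, Nat.sub_add_cancel h32⟩
  obtain ⟨hx2, hx5⟩ := cert_aux_x hx hy2 hy5 hw5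
  have hx0 : 0 < x := Nat.pos_of_ne_zero fun h => by simp [h] at hx2
  have hxY : x + Y = 50 * w := (cert_aux_lin (x := x) hyX hXW h81 hw).2.2.2 hx
  -- Step 6: coprimality
  have cop_r_q : Nat.Coprime r q := by
    rw [← hr4]
    have h4 : Nat.Coprime r 4 := by
      have e : (4 : ℕ) = 2 ^ 2 := by norm_num
      rw [e]
      exact Nat.Coprime.pow_right 2 (Nat.coprime_two_right.mpr (Nat.odd_iff.mpr hr2))
    exact Nat.coprime_self_add_right.mpr h4
  have hsw : ¬ s ∣ w := by
    intro hd
    have h1 : s ∣ 18 * w + y := by rw [hw, hY]; exact dvd_pow_self s (by norm_num)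
    have h2 : s ∣ y := (Nat.dvd_add_right (dvd_mul_of_dvd_right hd 18)).mp h1
    exact hsy h2
  have cop_s_w : Nat.Coprime s w := (Nat.Prime.coprime_iff_not_dvd hs).mpr hsw
  have cop_Y_y : Nat.Coprime Y y := by rw [hY]; exact Nat.Coprime.pow_left 4 cop_s_y
  have cop_18w_y : Nat.Coprime (18 * w) y := Nat.coprime_add_self_left.mp (by rw [hw]; exact cop_Y_y)
  have cop_w_y : Nat.Coprime w y := Nat.Coprime.coprime_dvd_left (dvd_mul_left w 18) cop_18w_y
  have cop_2_y : Nat.Coprime 2 y :=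
    (Nat.Prime.coprime_iff_not_dvd Nat.prime_two).mpr (Nat.two_dvd_ne_zero.mpr hy2)
  have cop_32_y : Nat.Coprime 32 y := by
    have e : (32 : ℕ) = 2 ^ 5 := by norm_num
    rw [e]; exact Nat.Coprime.pow_left 5 cop_2_y
  have cop_32w_y : Nat.Coprime (32 * w) y := Nat.Coprime.mul_left cop_32_y cop_w_y
  have cop_x_y : Nat.Coprime x y := Nat.coprime_add_self_left.mp (by rw [hx]; exact cop_32w_y)
  have cop_s_2 : Nat.Coprime s 2 :=
    (Nat.coprime_primes hs Nat.prime_two).mpr (Nat.ne_of_gt (lt_trans (by norm_num) hsbig))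
  have cop_s_5 : Nat.Coprime s 5 := (Nat.coprime_primes hs (by norm_num)).mpr hs5
  have cop_s_50 : Nat.Coprime s 50 := by
    have e : (50 : ℕ) = 2 * 5 ^ 2 := by norm_num
    rw [e]; exact Nat.Coprime.mul_right cop_s_2 (Nat.Coprime.pow_right 2 cop_s_5)
  have cop_Y_50w : Nat.Coprime Y (50 * w) := by
    rw [hY]; exact Nat.Coprime.pow_left 4 (Nat.Coprime.mul_right cop_s_50 cop_s_w)
  have cop_x_Y : Nat.Coprime x Y := by
    have h1 : Nat.Coprime (50 * w) Y := cop_Y_50w.symm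
    exact Nat.coprime_add_self_left.mp (by rw [hxY]; exact h1)
  have cop_r_2 : Nat.Coprime r 2 := Nat.coprime_two_right.mpr (Nat.odd_iff.mpr hr2)
  have cop_r_16W : Nat.Coprime r (16 * W) := by
    have e : (16 : ℕ) = 2 ^ 4 := by norm_num
    rw [e, hW]
    exact Nat.Coprime.mul_right (Nat.Coprime.pow_right 4 cop_r_2) (Nat.Coprime.pow_right 4 cop_r_q)
  have cop_X_16W : Nat.Coprime X (16 * W) := by rw [hX]; exact Nat.Coprime.pow_left 4 cop_r_16W
  have cop_X_y : Nat.Coprime X y := by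
    have h1 : Nat.Coprime X (y + X) := by rw [hyX]; exact cop_X_16W
    exact Nat.coprime_add_self_right.mp h1
  exact ⟨s, q, r, X, W, y, Y, w, x, hS₀, hs, hX, hW, hY, hyX, hw, hx, hxY, hXW, hWX, h81, h256,
    hr0, hw0, hx0, hy0, hr2, hq2, hs2, hw2, hx2, hy2, hy3, hx5, hw5, hs5,
    cop_r_q, cop_s_y, cop_s_w, cop_x_y, cop_x_Y, cop_X_y⟩

end Summit.ABC.ABC.Theorems.TameLocalReceptacle
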